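import Mathlib.Tactic.Ring
import Mathlib.Tactic.Linarith
import Mathlib.Tactic.Positivity
import Mathlib.Tactic.LinearCombination
import Mathlib.Data.Real.Basic
import HarnessLib

/-!
# Conjecture N (hodge-weil ladder, GAPS G51b), format (5,3): SEPARATED ALPHABETS — the positivity that pairwise ampleness gives

Prover 2, generation 17 (note `run/shared/lean/b2b/hodge-weil/b2b-hweil-pv2-g17/REAL-N53-G17.md` §5, the 'time picture'). Let the E-charges move
with velocities `A_e` and the F-charges with velocities `B_g` (`U_e(y) = u_e + yA_e`, `w_g(y) = v_g + yB_g`). Pairwise ampleness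
`|u_e − v_g| ≤ A_e − B_g` says exactly that at time `y = 1` every E-charge is right of every F-charge (`v_g + B_g ≤ u_e + A_e`) and at time
`y = −1` left of it (`A_e − u_e ≥ B_g − v_g`) — a SEPARATED virtual alphabet `L = {x_e} ⊖ {y_g}`; centring gives `Σx = Σy`.
LEMMA (`p3_nonneg_sep`, `e4_nonneg_sep`): a separated centred (5,3) alphabet has `Σx³ − Σy³ ≥ 0` (`e₃(L) ≥ 0`) and
`(Σx² − Σy²)² − 2(Σx⁴ − Σy⁴) ≥ 0` (`8e₄(L) ≥ 0`, i.e. `Q₄(L) = 3S₄ − (3/2)S₂² ≤ 0`). PROOF: with `c = max y` (three cases) one has `c ≤ 0`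
(`5c ≤ Σx = Σy ≤ 3c`) and `e_k(L − c) = Σ_j e_j(x − c)·h_{k−j}(c − y) ≥ 0` termwise (Pólya frequency), while for rank-two alphabets with
`e₁ = 0`: `e₃(L) = e₃(L − c)` and `e₄(L) = e₄(L − c) − c·e₃(L − c)` — two `ring` identities after eliminating `x₅`, then `positivity`.
COROLLARY (`lightcone_plus`, `lightcone_minus`): every centred pairwise-ample (5,3) configuration satisfies `Σε(u+A)³ ≥ 0`, `Q₄(u+A) ≤ 0`,
`Σε(A−u)³ ≥ 0`, `Q₄(A−u) ≤ 0` — necessary conditions in the light-cone charge vectors `P = A + u`, `M = A − u` of pv2-g9 (no purity needed).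
Pure algebra; nothing here is a case of HC, a rung or a door edge; no statement of Markman's papers is used. New cell result ⇒ Summits/.
-/

set_option linter.dupNamespace false

namespace Summit.HodgeConjecture.HodgeConjecture.WeilClassTestSeparatedAlphabet

set_option maxHeartbeats 800000 in
/-- `e₃ ≥ 0` for a separated centred alphabet, `y₁` the largest F-letter: `Σx³ − Σy³ = 3·Σ_j e_j(x − y₁)h_{3−j}(y₁ − y) ≥ 0`. -/
theorem p3_nonneg_sep₁ (x₁ x₂ x₃ x₄ x₅ y₁ y₂ y₃ : ℝ)
    (h : x₁ + x₂ + x₃ + x₄ + x₅ = y₁ + y₂ + y₃)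
    (hx₁ : y₁ ≤ x₁) (hx₂ : y₁ ≤ x₂) (hx₃ : y₁ ≤ x₃) (hx₄ : y₁ ≤ x₄) (hx₅ : y₁ ≤ x₅)
    (hy₂ : y₂ ≤ y₁) (hy₃ : y₃ ≤ y₁) :
    0 ≤ (x₁ ^ 3 + x₂ ^ 3 + x₃ ^ 3 + x₄ ^ 3 + x₅ ^ 3) - (y₁ ^ 3 + y₂ ^ 3 + y₃ ^ 3) := by
  have a₁ : 0 ≤ x₁ - y₁ := sub_nonneg.mpr hx₁
  have a₂ : 0 ≤ x₂ - y₁ := sub_nonneg.mpr hx₂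
  have a₃ : 0 ≤ x₃ - y₁ := sub_nonneg.mpr hx₃
  have a₄ : 0 ≤ x₄ - y₁ := sub_nonneg.mpr hx₄
  have a₅ : 0 ≤ x₅ - y₁ := sub_nonneg.mpr hx₅
  have b₂ : 0 ≤ y₁ - y₂ := sub_nonneg.mpr hy₂
  have b₃ : 0 ≤ y₁ - y₃ := sub_nonneg.mpr hy₃
  have key : (x₁ ^ 3 + x₂ ^ 3 + x₃ ^ 3 + x₄ ^ 3 + x₅ ^ 3) - (y₁ ^ 3 + y₂ ^ 3 + y₃ ^ 3)
      = 3 * (((y₁ - y₂) * (y₁ - y₂) * (y₁ - y₂) + (y₁ - y₂) * (y₁ - y₂) * (y₁ - y₃) + (y₁ - y₂) * (y₁ - y₃) * (y₁ - y₃) + (y₁ - y₃) * (y₁ - y₃) * (y₁ - y₃)) + ((x₁ - y₁) + (x₂ - y₁) + (x₃ - y₁) + (x₄ - y₁) + (x₅ - y₁)) * ((y₁ - y₂) * (y₁ - y₂) + (y₁ - y₂) * (y₁ - y₃) + (y₁ - y₃) * (y₁ - y₃)) + ((x₁ - y₁) * (x₂ - y₁) + (x₁ - y₁) * (x₃ -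 y₁) + (x₁ - y₁) * (x₄ - y₁) + (x₁ - y₁) * (x₅ - y₁) + (x₂ - y₁) * (x₃ - y₁) + (x₂ - y₁) * (x₄ - y₁) + (x₂ - y₁) * (x₅ - y₁) + (x₃ - y₁) * (x₄ - y₁) + (x₃ - y₁) * (x₅ - y₁) + (x₄ - y₁) * (x₅ - y₁)) * ((y₁ - y₂) + (y₁ - y₃)) + ((x₁ - y₁) * (x₂ - y₁) * (x₃ - y₁) + (x₁ - y₁) * (x₂ - y₁) * (x₄ - y₁) + (x₁ - y₁) * (x₂ - y₁) * (x₅ - y₁) + (x₁ - y₁) * (x₃ - y₁) * (x₄ - y₁) + (x₁ - y₁) * (x₃ - y₁) * (x₅ - y₁) + (x₁ - y₁) * (x₄ - y₁) * (x₅ - y₁) + (x₂ - y₁) * (x₃ - y₁) * (x₄ - y₁) + (x₂ - y₁) * (x₃ - y₁) * (x₅ - y₁) + (x₂ - y₁) * (x₄ - y₁) * (x₅ - y₁) + (x₃ - y₁) * (x₄ - y₁) * (x₅ - y₁))) := by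
    have hx : x₅ = y₁ + y₂ + y₃ - x₁ - x₂ - x₃ - x₄ := by linarith
    rw [hx]; ring
  rw [key]; positivity

set_option maxHeartbeats 800000 in
/-- `8e₄ = (Σx² − Σy²)² − 2(Σx⁴ − Σy⁴) ≥ 0` for a separated centred alphabet, `y₁` the largest F-letter (then `y₁ ≤ 0`):
`= 8·[e₄(L − y₁) + (−y₁)·e₃(L − y₁)]`, all terms nonnegative. Equivalently `Q₄(L) ≤ 0`. -/
theorem e4_nonneg_sep₁ (x₁ x₂ x₃ x₄ x₅ y₁ y₂ y₃ : ℝ)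
    (h : x₁ + x₂ + x₃ + x₄ + x₅ = y₁ + y₂ + y₃)
    (hx₁ : y₁ ≤ x₁) (hx₂ : y₁ ≤ x₂) (hx₃ : y₁ ≤ x₃) (hx₄ : y₁ ≤ x₄) (hx₅ : y₁ ≤ x₅)
    (hy₂ : y₂ ≤ y₁) (hy₃ : y₃ ≤ y₁) :
    0 ≤ ((x₁ ^ 2 + x₂ ^ 2 + x₃ ^ 2 + x₄ ^ 2 + x₅ ^ 2) - (y₁ ^ 2 + y₂ ^ 2 + y₃ ^ 2)) ^ 2 - 2 * ((x₁ ^ 4 + x₂ ^ 4 + x₃ ^ 4 + x₄ ^ 4 + x₅ ^ 4) - (y₁ ^ 4 + y₂ ^ 4 + y₃ ^ 4)) := by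
  have a₁ : 0 ≤ x₁ - y₁ := sub_nonneg.mpr hx₁
  have a₂ : 0 ≤ x₂ - y₁ := sub_nonneg.mpr hx₂
  have a₃ : 0 ≤ x₃ - y₁ := sub_nonneg.mpr hx₃
  have a₄ : 0 ≤ x₄ - y₁ := sub_nonneg.mpr hx₄
  have a₅ : 0 ≤ x₅ - y₁ := sub_nonneg.mpr hx₅
  have b₂ : 0 ≤ y₁ - y₂ := sub_nonneg.mpr hy₂
  have b₃ : 0 ≤ y₁ - y₃ := sub_nonneg.mpr hy₃
  have hc : 0 ≤ -y₁ := by linarith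
  have key : ((x₁ ^ 2 + x₂ ^ 2 + x₃ ^ 2 + x₄ ^ 2 + x₅ ^ 2) - (y₁ ^ 2 + y₂ ^ 2 + y₃ ^ 2)) ^ 2 - 2 * ((x₁ ^ 4 + x₂ ^ 4 + x₃ ^ 4 + x₄ ^ 4 + x₅ ^ 4) - (y₁ ^ 4 + y₂ ^ 4 + y₃ ^ 4))
      = 8 * ((((y₁ - y₂) * (y₁ - y₂) * (y₁ - y₂) * (y₁ - y₂) + (y₁ - y₂) * (y₁ - y₂) * (y₁ - y₂) * (y₁ - y₃) + (y₁ - y₂) * (y₁ - y₂) * (y₁ - y₃) * (y₁ - y₃) + (y₁ - y₂) * (y₁ - y₃) * (y₁ - y₃) * (y₁ - y₃) + (y₁ - y₃) * (y₁ - y₃) * (y₁ - y₃) * (y₁ - y₃)) + ((x₁ - y₁) + (x₂ - y₁) + (x₃ - y₁) + (x₄ - y₁) + (x₅ - y₁)) * ((y₁ - y₂) * (y₁ - y₂) * (y₁ - y₂) + (y₁ - y₂) * (y₁ - y₂) * (y₁ - y₃) + (y₁ - y₂) * (y₁ - y₃) * (y₁ - y₃) + (y₁ - y₃) * (y₁ -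 y₃) * (y₁ - y₃)) + ((x₁ - y₁) * (x₂ - y₁) + (x₁ - y₁) * (x₃ - y₁) + (x₁ - y₁) * (x₄ - y₁) + (x₁ - y₁) * (x₅ - y₁) + (x₂ - y₁) * (x₃ - y₁) + (x₂ - y₁) * (x₄ - y₁) + (x₂ - y₁) * (x₅ - y₁) + (x₃ - y₁) * (x₄ - y₁) + (x₃ - y₁) * (x₅ - y₁) + (x₄ - y₁) * (x₅ - y₁)) * ((y₁ - y₂) * (y₁ - y₂) + (y₁ - y₂) * (y₁ - y₃) + (y₁ - y₃) * (y₁ - y₃)) + ((x₁ - y₁) * (x₂ - y₁) * (x₃ - y₁) + (x₁ - y₁) * (x₂ - y₁) * (x₄ - y₁) + (x₁ - y₁) * (x₂ - y₁) * (x₅ - y₁) + (x₁ - y₁) * (x₃ - y₁) * (x₄ - y₁) + (x₁ - y₁) * (x₃ - y₁) * (x₅ - y₁) + (x₁ - y₁) * (x₄ - y₁) * (x₅ - y₁) + (x₂ - y₁) * (x₃ - y₁) * (x₄ - y₁) + (x₂ - y₁) * (x₃ - y₁) * (x₅ - y₁) + (x₂ - y₁) * (x₄ - y₁) * (x₅ -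 y₁) + (x₃ - y₁) * (x₄ - y₁) * (x₅ - y₁)) * ((y₁ - y₂) + (y₁ - y₃)) + ((x₁ - y₁) * (x₂ - y₁) * (x₃ - y₁) * (x₄ - y₁) + (x₁ - y₁) * (x₂ - y₁) * (x₃ - y₁) * (x₅ - y₁) + (x₁ - y₁) * (x₂ - y₁) * (x₄ - y₁) * (x₅ - y₁) + (x₁ - y₁) * (x₃ - y₁) * (x₄ - y₁) * (x₅ - y₁) + (x₂ - y₁) * (x₃ - y₁) * (x₄ - y₁) * (x₅ - y₁))) + (-y₁) * (((y₁ - y₂) * (y₁ - y₂) * (y₁ - y₂) + (y₁ - y₂) * (y₁ - y₂) * (y₁ - y₃) + (y₁ - y₂) * (y₁ - y₃) * (y₁ - y₃) + (y₁ - y₃) * (y₁ - y₃) * (y₁ - y₃)) + ((x₁ - y₁) + (x₂ - y₁) + (x₃ - y₁) + (x₄ - y₁) + (x₅ - y₁)) * ((y₁ - y₂) * (y₁ - y₂) + (y₁ - y₂) * (y₁ - y₃) + (y₁ - y₃) * (y₁ - y₃)) + ((x₁ - y₁) * (x₂ - y₁) + (x₁ - y₁) * (x₃ - y₁) + (x₁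 - y₁) * (x₄ - y₁) + (x₁ - y₁) * (x₅ - y₁) + (x₂ - y₁) * (x₃ - y₁) + (x₂ - y₁) * (x₄ - y₁) + (x₂ - y₁) * (x₅ - y₁) + (x₃ - y₁) * (x₄ - y₁) + (x₃ - y₁) * (x₅ - y₁) + (x₄ - y₁) * (x₅ - y₁)) * ((y₁ - y₂) + (y₁ - y₃)) + ((x₁ - y₁) * (x₂ - y₁) * (x₃ - y₁) + (x₁ - y₁) * (x₂ - y₁) * (x₄ - y₁) + (x₁ - y₁) * (x₂ - y₁) * (x₅ - y₁) + (x₁ - y₁) * (x₃ - y₁) * (x₄ - y₁) + (x₁ - y₁) * (x₃ - y₁) * (x₅ - y₁) + (x₁ - y₁) * (x₄ - y₁) * (x₅ - y₁) + (x₂ - y₁) * (x₃ - y₁) * (x₄ - y₁) + (x₂ - y₁) * (x₃ - y₁) * (x₅ - y₁) + (x₂ - y₁) * (x₄ - y₁) * (x₅ - y₁) + (x₃ - y₁) * (x₄ - y₁) * (x₅ - y₁)))) := by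
    have hx : x₅ = y₁ + y₂ + y₃ - x₁ - x₂ - x₃ - x₄ := by linarith
    rw [hx]; ring
  rw [key]; positivity

set_option maxHeartbeats 800000 in
/-- `e₃ ≥ 0` for a separated centred alphabet, `y₂` the largest F-letter: `Σx³ − Σy³ = 3·Σ_j e_j(x − y₂)h_{3−j}(y₂ − y) ≥ 0`. -/
theorem p3_nonneg_sep₂ (x₁ x₂ x₃ x₄ x₅ y₁ y₂ y₃ : ℝ)
    (h : x₁ + x₂ + x₃ + x₄ + x₅ = y₁ + y₂ + y₃)
    (hx₁ : y₂ ≤ x₁) (hx₂ : y₂ ≤ x₂) (hx₃ : y₂ ≤ x₃) (hx₄ : y₂ ≤ x₄) (hx₅ : y₂ ≤ x₅)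
    (hy₁ : y₁ ≤ y₂) (hy₃ : y₃ ≤ y₂) :
    0 ≤ (x₁ ^ 3 + x₂ ^ 3 + x₃ ^ 3 + x₄ ^ 3 + x₅ ^ 3) - (y₁ ^ 3 + y₂ ^ 3 + y₃ ^ 3) := by
  have a₁ : 0 ≤ x₁ - y₂ := sub_nonneg.mpr hx₁
  have a₂ : 0 ≤ x₂ - y₂ := sub_nonneg.mpr hx₂
  have a₃ : 0 ≤ x₃ - y₂ := sub_nonneg.mpr hx₃
  have a₄ : 0 ≤ x₄ - y₂ := sub_nonneg.mpr hx₄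
  have a₅ : 0 ≤ x₅ - y₂ := sub_nonneg.mpr hx₅
  have b₁ : 0 ≤ y₂ - y₁ := sub_nonneg.mpr hy₁
  have b₃ : 0 ≤ y₂ - y₃ := sub_nonneg.mpr hy₃
  have key : (x₁ ^ 3 + x₂ ^ 3 + x₃ ^ 3 + x₄ ^ 3 + x₅ ^ 3) - (y₁ ^ 3 + y₂ ^ 3 + y₃ ^ 3)
      = 3 * (((y₂ - y₁) * (y₂ - y₁) * (y₂ - y₁) + (y₂ - y₁) * (y₂ - y₁) * (y₂ - y₃) + (y₂ - y₁) * (y₂ - y₃) * (y₂ - y₃) + (y₂ - y₃) * (y₂ - y₃) * (y₂ - y₃)) + ((x₁ - y₂) + (x₂ - y₂) + (x₃ - y₂) + (x₄ - y₂) + (x₅ - y₂)) * ((y₂ - y₁) * (y₂ - y₁) + (y₂ - y₁) * (y₂ - y₃) + (y₂ - y₃) * (y₂ - y₃)) + ((x₁ - y₂) * (x₂ - y₂) + (x₁ - y₂) * (x₃ - y₂) + (x₁ - y₂) * (x₄ - y₂) + (x₁ - y₂) * (x₅ - y₂) + (x₂ - y₂) * (x₃ - y₂) + (x₂ - y₂)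 * (x₄ - y₂) + (x₂ - y₂) * (x₅ - y₂) + (x₃ - y₂) * (x₄ - y₂) + (x₃ - y₂) * (x₅ - y₂) + (x₄ - y₂) * (x₅ - y₂)) * ((y₂ - y₁) + (y₂ - y₃)) + ((x₁ - y₂) * (x₂ - y₂) * (x₃ - y₂) + (x₁ - y₂) * (x₂ - y₂) * (x₄ - y₂) + (x₁ - y₂) * (x₂ - y₂) * (x₅ - y₂) + (x₁ - y₂) * (x₃ - y₂) * (x₄ - y₂) + (x₁ - y₂) * (x₃ - y₂) * (x₅ - y₂) + (x₁ - y₂) * (x₄ - y₂) * (x₅ - y₂) + (x₂ - y₂) * (x₃ - y₂) * (x₄ - y₂) + (x₂ - y₂) * (x₃ - y₂) * (x₅ - y₂) + (x₂ - y₂) * (x₄ - y₂) * (x₅ - y₂) + (x₃ - y₂) * (x₄ - y₂) * (x₅ - y₂))) := by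
    have hx : x₅ = y₁ + y₂ + y₃ - x₁ - x₂ - x₃ - x₄ := by linarith
    rw [hx]; ring
  rw [key]; positivity

set_option maxHeartbeats 800000 in
/-- `8e₄ = (Σx² − Σy²)² − 2(Σx⁴ − Σy⁴) ≥ 0` for a separated centred alphabet, `y₂` the largest F-letter (then `y₂ ≤ 0`):
`= 8·[e₄(L − y₂) + (−y₂)·e₃(L − y₂)]`, all terms nonnegative. Equivalently `Q₄(L) ≤ 0`. -/
theorem e4_nonneg_sep₂ (x₁ x₂ x₃ x₄ x₅ y₁ y₂ y₃ : ℝ)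
    (h : x₁ + x₂ + x₃ + x₄ + x₅ = y₁ + y₂ + y₃)
    (hx₁ : y₂ ≤ x₁) (hx₂ : y₂ ≤ x₂) (hx₃ : y₂ ≤ x₃) (hx₄ : y₂ ≤ x₄) (hx₅ : y₂ ≤ x₅)
    (hy₁ : y₁ ≤ y₂) (hy₃ : y₃ ≤ y₂) :
    0 ≤ ((x₁ ^ 2 + x₂ ^ 2 + x₃ ^ 2 + x₄ ^ 2 + x₅ ^ 2) - (y₁ ^ 2 + y₂ ^ 2 + y₃ ^ 2)) ^ 2 - 2 * ((x₁ ^ 4 + x₂ ^ 4 + x₃ ^ 4 + x₄ ^ 4 + x₅ ^ 4) - (y₁ ^ 4 + y₂ ^ 4 + y₃ ^ 4)) := by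
  have a₁ : 0 ≤ x₁ - y₂ := sub_nonneg.mpr hx₁
  have a₂ : 0 ≤ x₂ - y₂ := sub_nonneg.mpr hx₂
  have a₃ : 0 ≤ x₃ - y₂ := sub_nonneg.mpr hx₃
  have a₄ : 0 ≤ x₄ - y₂ := sub_nonneg.mpr hx₄
  have a₅ : 0 ≤ x₅ - y₂ := sub_nonneg.mpr hx₅
  have b₁ : 0 ≤ y₂ - y₁ := sub_nonneg.mpr hy₁
  have b₃ : 0 ≤ y₂ - y₃ := sub_nonneg.mpr hy₃
  have hc : 0 ≤ -y₂ := by linarith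
  have key : ((x₁ ^ 2 + x₂ ^ 2 + x₃ ^ 2 + x₄ ^ 2 + x₅ ^ 2) - (y₁ ^ 2 + y₂ ^ 2 + y₃ ^ 2)) ^ 2 - 2 * ((x₁ ^ 4 + x₂ ^ 4 + x₃ ^ 4 + x₄ ^ 4 + x₅ ^ 4) - (y₁ ^ 4 + y₂ ^ 4 + y₃ ^ 4))
      = 8 * ((((y₂ - y₁) * (y₂ - y₁) * (y₂ - y₁) * (y₂ - y₁) + (y₂ - y₁) * (y₂ - y₁) * (y₂ - y₁) * (y₂ - y₃) + (y₂ - y₁) * (y₂ - y₁) * (y₂ - y₃) * (y₂ - y₃) + (y₂ - y₁) * (y₂ - y₃) * (y₂ - y₃) * (y₂ - y₃) + (y₂ - y₃) * (y₂ - y₃) * (y₂ - y₃) * (y₂ - y₃)) + ((x₁ - y₂) + (x₂ - y₂) + (x₃ - y₂) + (x₄ - y₂) + (x₅ - y₂)) * ((y₂ - y₁) * (y₂ - y₁) * (y₂ - y₁) + (y₂ - y₁) * (y₂ - y₁) * (y₂ - y₃) + (y₂ - y₁) * (y₂ - y₃) * (y₂ - y₃) + (y₂ - y₃) * (y₂ -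 y₃) * (y₂ - y₃)) + ((x₁ - y₂) * (x₂ - y₂) + (x₁ - y₂) * (x₃ - y₂) + (x₁ - y₂) * (x₄ - y₂) + (x₁ - y₂) * (x₅ - y₂) + (x₂ - y₂) * (x₃ - y₂) + (x₂ - y₂) * (x₄ - y₂) + (x₂ - y₂) * (x₅ - y₂) + (x₃ - y₂) * (x₄ - y₂) + (x₃ - y₂) * (x₅ - y₂) + (x₄ - y₂) * (x₅ - y₂)) * ((y₂ - y₁) * (y₂ - y₁) + (y₂ - y₁) * (y₂ - y₃) + (y₂ - y₃) * (y₂ - y₃)) + ((x₁ - y₂) * (x₂ - y₂) * (x₃ - y₂) + (x₁ - y₂) * (x₂ - y₂) * (x₄ - y₂) + (x₁ - y₂) * (x₂ - y₂) * (x₅ - y₂) + (x₁ - y₂) * (x₃ - y₂) * (x₄ - y₂) + (x₁ - y₂) * (x₃ - y₂) * (x₅ - y₂) + (x₁ - y₂) * (x₄ - y₂) * (x₅ - y₂) + (x₂ - y₂) * (x₃ - y₂) * (x₄ - y₂) + (x₂ - y₂) * (x₃ - y₂) * (x₅ - y₂) + (x₂ - y₂) * (x₄ - y₂) * (x₅ -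 y₂) + (x₃ - y₂) * (x₄ - y₂) * (x₅ - y₂)) * ((y₂ - y₁) + (y₂ - y₃)) + ((x₁ - y₂) * (x₂ - y₂) * (x₃ - y₂) * (x₄ - y₂) + (x₁ - y₂) * (x₂ - y₂) * (x₃ - y₂) * (x₅ - y₂) + (x₁ - y₂) * (x₂ - y₂) * (x₄ - y₂) * (x₅ - y₂) + (x₁ - y₂) * (x₃ - y₂) * (x₄ - y₂) * (x₅ - y₂) + (x₂ - y₂) * (x₃ - y₂) * (x₄ - y₂) * (x₅ - y₂))) + (-y₂) * (((y₂ - y₁) * (y₂ - y₁) * (y₂ - y₁) + (y₂ - y₁) * (y₂ - y₁) * (y₂ - y₃) + (y₂ - y₁) * (y₂ - y₃) * (y₂ - y₃) + (y₂ - y₃) * (y₂ - y₃) * (y₂ - y₃)) + ((x₁ - y₂) + (x₂ - y₂) + (x₃ - y₂) + (x₄ - y₂) + (x₅ - y₂)) * ((y₂ - y₁) * (y₂ - y₁) + (y₂ - y₁) * (y₂ - y₃) + (y₂ - y₃) * (y₂ - y₃)) + ((x₁ - y₂) * (x₂ - y₂) + (x₁ - y₂) * (x₃ - y₂) + (x₁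 - y₂) * (x₄ - y₂) + (x₁ - y₂) * (x₅ - y₂) + (x₂ - y₂) * (x₃ - y₂) + (x₂ - y₂) * (x₄ - y₂) + (x₂ - y₂) * (x₅ - y₂) + (x₃ - y₂) * (x₄ - y₂) + (x₃ - y₂) * (x₅ - y₂) + (x₄ - y₂) * (x₅ - y₂)) * ((y₂ - y₁) + (y₂ - y₃)) + ((x₁ - y₂) * (x₂ - y₂) * (x₃ - y₂) + (x₁ - y₂) * (x₂ - y₂) * (x₄ - y₂) + (x₁ - y₂) * (x₂ - y₂) * (x₅ - y₂) + (x₁ - y₂) * (x₃ - y₂) * (x₄ - y₂) + (x₁ - y₂) * (x₃ - y₂) * (x₅ - y₂) + (x₁ - y₂) * (x₄ - y₂) * (x₅ - y₂) + (x₂ - y₂) * (x₃ - y₂) * (x₄ - y₂) + (x₂ - y₂) * (x₃ - y₂) * (x₅ - y₂) + (x₂ - y₂) * (x₄ - y₂) * (x₅ - y₂) + (x₃ - y₂) * (x₄ - y₂) * (x₅ - y₂)))) := by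
    have hx : x₅ = y₁ + y₂ + y₃ - x₁ - x₂ - x₃ - x₄ := by linarith
    rw [hx]; ring
  rw [key]; positivity

set_option maxHeartbeats 800000 in
/-- `e₃ ≥ 0` for a separated centred alphabet, `y₃` the largest F-letter: `Σx³ − Σy³ = 3·Σ_j e_j(x − y₃)h_{3−j}(y₃ − y) ≥ 0`. -/
theorem p3_nonneg_sep₃ (x₁ x₂ x₃ x₄ x₅ y₁ y₂ y₃ : ℝ)
    (h : x₁ + x₂ + x₃ + x₄ + x₅ = y₁ + y₂ + y₃)
    (hx₁ : y₃ ≤ x₁) (hx₂ : y₃ ≤ x₂) (hx₃ : y₃ ≤ x₃) (hx₄ : y₃ ≤ x₄) (hx₅ : y₃ ≤ x₅)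
    (hy₁ : y₁ ≤ y₃) (hy₂ : y₂ ≤ y₃) :
    0 ≤ (x₁ ^ 3 + x₂ ^ 3 + x₃ ^ 3 + x₄ ^ 3 + x₅ ^ 3) - (y₁ ^ 3 + y₂ ^ 3 + y₃ ^ 3) := by
  have a₁ : 0 ≤ x₁ - y₃ := sub_nonneg.mpr hx₁
  have a₂ : 0 ≤ x₂ - y₃ := sub_nonneg.mpr hx₂
  have a₃ : 0 ≤ x₃ - y₃ := sub_nonneg.mpr hx₃
  have a₄ : 0 ≤ x₄ - y₃ := sub_nonneg.mpr hx₄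
  have a₅ : 0 ≤ x₅ - y₃ := sub_nonneg.mpr hx₅
  have b₁ : 0 ≤ y₃ - y₁ := sub_nonneg.mpr hy₁
  have b₂ : 0 ≤ y₃ - y₂ := sub_nonneg.mpr hy₂
  have key : (x₁ ^ 3 + x₂ ^ 3 + x₃ ^ 3 + x₄ ^ 3 + x₅ ^ 3) - (y₁ ^ 3 + y₂ ^ 3 + y₃ ^ 3)
      = 3 * (((y₃ - y₁) * (y₃ - y₁) * (y₃ - y₁) + (y₃ - y₁) * (y₃ - y₁) * (y₃ - y₂) + (y₃ - y₁) * (y₃ - y₂) * (y₃ - y₂) + (y₃ - y₂) * (y₃ - y₂) * (y₃ - y₂)) + ((x₁ - y₃) + (x₂ - y₃) + (x₃ - y₃) + (x₄ - y₃) + (x₅ - y₃)) * ((y₃ - y₁) * (y₃ - y₁) + (y₃ - y₁) * (y₃ - y₂) + (y₃ - y₂) * (y₃ - y₂)) + ((x₁ - y₃) * (x₂ - y₃) + (x₁ - y₃) * (x₃ - y₃) + (x₁ - y₃) * (x₄ - y₃) + (x₁ - y₃) * (x₅ - y₃) + (x₂ - y₃) * (x₃ - y₃) + (x₂ - y₃)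 * (x₄ - y₃) + (x₂ - y₃) * (x₅ - y₃) + (x₃ - y₃) * (x₄ - y₃) + (x₃ - y₃) * (x₅ - y₃) + (x₄ - y₃) * (x₅ - y₃)) * ((y₃ - y₁) + (y₃ - y₂)) + ((x₁ - y₃) * (x₂ - y₃) * (x₃ - y₃) + (x₁ - y₃) * (x₂ - y₃) * (x₄ - y₃) + (x₁ - y₃) * (x₂ - y₃) * (x₅ - y₃) + (x₁ - y₃) * (x₃ - y₃) * (x₄ - y₃) + (x₁ - y₃) * (x₃ - y₃) * (x₅ - y₃) + (x₁ - y₃) * (x₄ - y₃) * (x₅ - y₃) + (x₂ - y₃) * (x₃ - y₃) * (x₄ - y₃) + (x₂ - y₃) * (x₃ - y₃) * (x₅ - y₃) + (x₂ - y₃) * (x₄ - y₃) * (x₅ - y₃) + (x₃ - y₃) * (x₄ - y₃) * (x₅ - y₃))) := by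
    have hx : x₅ = y₁ + y₂ + y₃ - x₁ - x₂ - x₃ - x₄ := by linarith
    rw [hx]; ring
  rw [key]; positivity

set_option maxHeartbeats 800000 in
/-- `8e₄ = (Σx² − Σy²)² − 2(Σx⁴ − Σy⁴) ≥ 0` for a separated centred alphabet, `y₃` the largest F-letter (then `y₃ ≤ 0`):
`= 8·[e₄(L − y₃) + (−y₃)·e₃(L − y₃)]`, all terms nonnegative. Equivalently `Q₄(L) ≤ 0`. -/
theorem e4_nonneg_sep₃ (x₁ x₂ x₃ x₄ x₅ y₁ y₂ y₃ : ℝ)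
    (h : x₁ + x₂ + x₃ + x₄ + x₅ = y₁ + y₂ + y₃)
    (hx₁ : y₃ ≤ x₁) (hx₂ : y₃ ≤ x₂) (hx₃ : y₃ ≤ x₃) (hx₄ : y₃ ≤ x₄) (hx₅ : y₃ ≤ x₅)
    (hy₁ : y₁ ≤ y₃) (hy₂ : y₂ ≤ y₃) :
    0 ≤ ((x₁ ^ 2 + x₂ ^ 2 + x₃ ^ 2 + x₄ ^ 2 + x₅ ^ 2) - (y₁ ^ 2 + y₂ ^ 2 + y₃ ^ 2)) ^ 2 - 2 * ((x₁ ^ 4 + x₂ ^ 4 + x₃ ^ 4 + x₄ ^ 4 + x₅ ^ 4) - (y₁ ^ 4 + y₂ ^ 4 + y₃ ^ 4)) := by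
  have a₁ : 0 ≤ x₁ - y₃ := sub_nonneg.mpr hx₁
  have a₂ : 0 ≤ x₂ - y₃ := sub_nonneg.mpr hx₂
  have a₃ : 0 ≤ x₃ - y₃ := sub_nonneg.mpr hx₃
  have a₄ : 0 ≤ x₄ - y₃ := sub_nonneg.mpr hx₄
  have a₅ : 0 ≤ x₅ - y₃ := sub_nonneg.mpr hx₅
  have b₁ : 0 ≤ y₃ - y₁ := sub_nonneg.mpr hy₁
  have b₂ : 0 ≤ y₃ - y₂ := sub_nonneg.mpr hy₂
  have hc : 0 ≤ -y₃ := by linarith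
  have key : ((x₁ ^ 2 + x₂ ^ 2 + x₃ ^ 2 + x₄ ^ 2 + x₅ ^ 2) - (y₁ ^ 2 + y₂ ^ 2 + y₃ ^ 2)) ^ 2 - 2 * ((x₁ ^ 4 + x₂ ^ 4 + x₃ ^ 4 + x₄ ^ 4 + x₅ ^ 4) - (y₁ ^ 4 + y₂ ^ 4 + y₃ ^ 4))
      = 8 * ((((y₃ - y₁) * (y₃ - y₁) * (y₃ - y₁) * (y₃ - y₁) + (y₃ - y₁) * (y₃ - y₁) * (y₃ - y₁) * (y₃ - y₂) + (y₃ - y₁) * (y₃ - y₁) * (y₃ - y₂) * (y₃ - y₂) + (y₃ - y₁) * (y₃ - y₂) * (y₃ - y₂) * (y₃ - y₂) + (y₃ - y₂) * (y₃ - y₂) * (y₃ - y₂) * (y₃ - y₂)) + ((x₁ - y₃) + (x₂ - y₃) + (x₃ - y₃) + (x₄ - y₃) + (x₅ - y₃)) * ((y₃ - y₁) * (y₃ - y₁) * (y₃ - y₁) + (y₃ - y₁) * (y₃ - y₁) * (y₃ - y₂) + (y₃ - y₁) * (y₃ - y₂) * (y₃ - y₂) + (y₃ - y₂) * (y₃ -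 y₂) * (y₃ - y₂)) + ((x₁ - y₃) * (x₂ - y₃) + (x₁ - y₃) * (x₃ - y₃) + (x₁ - y₃) * (x₄ - y₃) + (x₁ - y₃) * (x₅ - y₃) + (x₂ - y₃) * (x₃ - y₃) + (x₂ - y₃) * (x₄ - y₃) + (x₂ - y₃) * (x₅ - y₃) + (x₃ - y₃) * (x₄ - y₃) + (x₃ - y₃) * (x₅ - y₃) + (x₄ - y₃) * (x₅ - y₃)) * ((y₃ - y₁) * (y₃ - y₁) + (y₃ - y₁) * (y₃ - y₂) + (y₃ - y₂) * (y₃ - y₂)) + ((x₁ - y₃) * (x₂ - y₃) * (x₃ - y₃) + (x₁ - y₃) * (x₂ - y₃) * (x₄ - y₃) + (x₁ - y₃) * (x₂ - y₃) * (x₅ - y₃) + (x₁ - y₃) * (x₃ - y₃) * (x₄ - y₃) + (x₁ - y₃) * (x₃ - y₃) * (x₅ - y₃) + (x₁ - y₃) * (x₄ - y₃) * (x₅ - y₃) + (x₂ - y₃) * (x₃ - y₃) * (x₄ - y₃) + (x₂ - y₃) * (x₃ - y₃) * (x₅ - y₃) + (x₂ - y₃) * (x₄ - y₃) * (x₅ -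 y₃) + (x₃ - y₃) * (x₄ - y₃) * (x₅ - y₃)) * ((y₃ - y₁) + (y₃ - y₂)) + ((x₁ - y₃) * (x₂ - y₃) * (x₃ - y₃) * (x₄ - y₃) + (x₁ - y₃) * (x₂ - y₃) * (x₃ - y₃) * (x₅ - y₃) + (x₁ - y₃) * (x₂ - y₃) * (x₄ - y₃) * (x₅ - y₃) + (x₁ - y₃) * (x₃ - y₃) * (x₄ - y₃) * (x₅ - y₃) + (x₂ - y₃) * (x₃ - y₃) * (x₄ - y₃) * (x₅ - y₃))) + (-y₃) * (((y₃ - y₁) * (y₃ - y₁) * (y₃ - y₁) + (y₃ - y₁) * (y₃ - y₁) * (y₃ - y₂) + (y₃ - y₁) * (y₃ - y₂) * (y₃ - y₂) + (y₃ - y₂) * (y₃ - y₂) * (y₃ - y₂)) + ((x₁ - y₃) + (x₂ - y₃) + (x₃ - y₃) + (x₄ - y₃) + (x₅ - y₃)) * ((y₃ - y₁) * (y₃ - y₁) + (y₃ - y₁) * (y₃ - y₂) + (y₃ - y₂) * (y₃ - y₂)) + ((x₁ - y₃) * (x₂ - y₃) + (x₁ - y₃) * (x₃ - y₃) + (x₁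 - y₃) * (x₄ - y₃) + (x₁ - y₃) * (x₅ - y₃) + (x₂ - y₃) * (x₃ - y₃) + (x₂ - y₃) * (x₄ - y₃) + (x₂ - y₃) * (x₅ - y₃) + (x₃ - y₃) * (x₄ - y₃) + (x₃ - y₃) * (x₅ - y₃) + (x₄ - y₃) * (x₅ - y₃)) * ((y₃ - y₁) + (y₃ - y₂)) + ((x₁ - y₃) * (x₂ - y₃) * (x₃ - y₃) + (x₁ - y₃) * (x₂ - y₃) * (x₄ - y₃) + (x₁ - y₃) * (x₂ - y₃) * (x₅ - y₃) + (x₁ - y₃) * (x₃ - y₃) * (x₄ - y₃) + (x₁ - y₃) * (x₃ - y₃) * (x₅ - y₃) + (x₁ - y₃) * (x₄ - y₃) * (x₅ - y₃) + (x₂ - y₃) * (x₃ - y₃) * (x₄ - y₃) + (x₂ - y₃) * (x₃ - y₃) * (x₅ - y₃) + (x₂ - y₃) * (x₄ - y₃) * (x₅ - y₃) + (x₃ - y₃) * (x₄ - y₃) * (x₅ - y₃)))) := by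
    have hx : x₅ = y₁ + y₂ + y₃ - x₁ - x₂ - x₃ - x₄ := by linarith
    rw [hx]; ring
  rw [key]; positivity

/-- `Σx³ ≥ Σy³` for every separated centred (5,3) alphabet (`y_g ≤ x_e` for all pairs, `Σx = Σy`). -/
theorem p3_nonneg_sep (x₁ x₂ x₃ x₄ x₅ y₁ y₂ y₃ : ℝ)
    (h : x₁ + x₂ + x₃ + x₄ + x₅ = y₁ + y₂ + y₃)
    (h₁₁ : y₁ ≤ x₁) (h₂₁ : y₁ ≤ x₂) (h₃₁ : y₁ ≤ x₃) (h₄₁ : y₁ ≤ x₄) (h₅₁ : y₁ ≤ x₅)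
    (h₁₂ : y₂ ≤ x₁) (h₂₂ : y₂ ≤ x₂) (h₃₂ : y₂ ≤ x₃) (h₄₂ : y₂ ≤ x₄) (h₅₂ : y₂ ≤ x₅)
    (h₁₃ : y₃ ≤ x₁) (h₂₃ : y₃ ≤ x₂) (h₃₃ : y₃ ≤ x₃) (h₄₃ : y₃ ≤ x₄) (h₅₃ : y₃ ≤ x₅) :
    0 ≤ (x₁ ^ 3 + x₂ ^ 3 + x₃ ^ 3 + x₄ ^ 3 + x₅ ^ 3) - (y₁ ^ 3 + y₂ ^ 3 + y₃ ^ 3) := by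
  rcases le_total y₁ y₃ with h13 | h31
  · rcases le_total y₂ y₃ with h23 | h32
    · exact p3_nonneg_sep₃ x₁ x₂ x₃ x₄ x₅ y₁ y₂ y₃ h h₁₃ h₂₃ h₃₃ h₄₃ h₅₃ h13 h23
    · exact p3_nonneg_sep₂ x₁ x₂ x₃ x₄ x₅ y₁ y₂ y₃ h h₁₂ h₂₂ h₃₂ h₄₂ h₅₂ (h13.trans h32) h32
  · rcases le_total y₂ y₁ with h21 | h12
    · exact p3_nonneg_sep₁ x₁ x₂ x₃ x₄ x₅ y₁ y₂ y₃ h h₁₁ h₂₁ h₃₁ h₄₁ h₅₁ h21 h31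
    · exact p3_nonneg_sep₂ x₁ x₂ x₃ x₄ x₅ y₁ y₂ y₃ h h₁₂ h₂₂ h₃₂ h₄₂ h₅₂ h12 (h31.trans h12)

/-- `(Σx² − Σy²)² ≥ 2(Σx⁴ − Σy⁴)` (`e₄(L) ≥ 0`, `Q₄(L) ≤ 0`) for every separated centred (5,3) alphabet. -/
theorem e4_nonneg_sep (x₁ x₂ x₃ x₄ x₅ y₁ y₂ y₃ : ℝ)
    (h : x₁ + x₂ + x₃ + x₄ + x₅ = y₁ + y₂ + y₃)
    (h₁₁ : y₁ ≤ x₁) (h₂₁ : y₁ ≤ x₂) (h₃₁ : y₁ ≤ x₃) (h₄₁ : y₁ ≤ x₄) (h₅₁ : y₁ ≤ x₅)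
    (h₁₂ : y₂ ≤ x₁) (h₂₂ : y₂ ≤ x₂) (h₃₂ : y₂ ≤ x₃) (h₄₂ : y₂ ≤ x₄) (h₅₂ : y₂ ≤ x₅)
    (h₁₃ : y₃ ≤ x₁) (h₂₃ : y₃ ≤ x₂) (h₃₃ : y₃ ≤ x₃) (h₄₃ : y₃ ≤ x₄) (h₅₃ : y₃ ≤ x₅) :
    0 ≤ ((x₁ ^ 2 + x₂ ^ 2 + x₃ ^ 2 + x₄ ^ 2 + x₅ ^ 2) - (y₁ ^ 2 + y₂ ^ 2 + y₃ ^ 2)) ^ 2 - 2 * ((x₁ ^ 4 + x₂ ^ 4 + x₃ ^ 4 + x₄ ^ 4 + x₅ ^ 4) - (y₁ ^ 4 + y₂ ^ 4 + y₃ ^ 4)) := by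
  rcases le_total y₁ y₃ with h13 | h31
  · rcases le_total y₂ y₃ with h23 | h32
    · exact e4_nonneg_sep₃ x₁ x₂ x₃ x₄ x₅ y₁ y₂ y₃ h h₁₃ h₂₃ h₃₃ h₄₃ h₅₃ h13 h23
    · exact e4_nonneg_sep₂ x₁ x₂ x₃ x₄ x₅ y₁ y₂ y₃ h h₁₂ h₂₂ h₃₂ h₄₂ h₅₂ (h13.trans h32) h32
  · rcases le_total y₂ y₁ with h21 | h12
    · exact e4_nonneg_sep₁ x₁ x₂ x₃ x₄ x₅ y₁ y₂ y₃ h h₁₁ h₂₁ h₃₁ h₄₁ h₅₁ h21 h31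
    · exact e4_nonneg_sep₂ x₁ x₂ x₃ x₄ x₅ y₁ y₂ y₃ h h₁₂ h₂₂ h₃₂ h₄₂ h₅₂ h12 (h31.trans h12)

/-- LIGHT-CONE NECESSARY CONDITIONS at time `y = +1` (`P = u + A`): for every centred pairwise-ample (5,3) configuration
`Σ_E (u+A)³ − Σ_F (v+B)³ ≥ 0` and `Q₄(P) = 3S₄(P) − (3/2)S₂(P)² ≤ 0`. -/
theorem lightcone_plus (A₁ A₂ A₃ A₄ A₅ B₁ B₂ B₃ u₁ u₂ u₃ u₄ u₅ v₁ v₂ v₃ : ℝ)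
    (hA : A₁ + A₂ + A₃ + A₄ + A₅ = B₁ + B₂ + B₃) (hC : u₁ + u₂ + u₃ + u₄ + u₅ = v₁ + v₂ + v₃)
    (m₁₁ : |u₁ - v₁| ≤ A₁ - B₁) (m₂₁ : |u₂ - v₁| ≤ A₂ - B₁) (m₃₁ : |u₃ - v₁| ≤ A₃ - B₁) (m₄₁ : |u₄ - v₁| ≤ A₄ - B₁) (m₅₁ : |u₅ - v₁| ≤ A₅ - B₁)
    (m₁₂ : |u₁ - v₂| ≤ A₁ - B₂) (m₂₂ : |u₂ - v₂| ≤ A₂ - B₂) (m₃₂ : |u₃ - v₂| ≤ A₃ - B₂) (m₄₂ : |u₄ - v₂| ≤ A₄ - B₂) (m₅₂ : |u₅ - v₂| ≤ A₅ - B₂)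
    (m₁₃ : |u₁ - v₃| ≤ A₁ - B₃) (m₂₃ : |u₂ - v₃| ≤ A₂ - B₃) (m₃₃ : |u₃ - v₃| ≤ A₃ - B₃) (m₄₃ : |u₄ - v₃| ≤ A₄ - B₃) (m₅₃ : |u₅ - v₃| ≤ A₅ - B₃) :
    0 ≤ (((u₁ + A₁) ^ 3 + (u₂ + A₂) ^ 3 + (u₃ + A₃) ^ 3 + (u₄ + A₄) ^ 3 + (u₅ + A₅) ^ 3) - ((v₁ + B₁) ^ 3 + (v₂ + B₂) ^ 3 + (v₃ + B₃) ^ 3))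
    ∧ 3 * (((u₁ + A₁) ^ 4 + (u₂ + A₂) ^ 4 + (u₃ + A₃) ^ 4 + (u₄ + A₄) ^ 4 + (u₅ + A₅) ^ 4) - ((v₁ + B₁) ^ 4 + (v₂ + B₂) ^ 4 + (v₃ + B₃) ^ 4)) - (3 / 2) * (((u₁ + A₁) ^ 2 + (u₂ + A₂) ^ 2 + (u₃ + A₃) ^ 2 + (u₄ + A₄) ^ 2 + (u₅ + A₅) ^ 2) - ((v₁ + B₁) ^ 2 + (v₂ + B₂) ^ 2 + (v₃ + B₃) ^ 2)) ^ 2 ≤ 0 := by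
  have h : (u₁ + A₁) + (u₂ + A₂) + (u₃ + A₃) + (u₄ + A₄) + (u₅ + A₅) = (v₁ + B₁) + (v₂ + B₂) + (v₃ + B₃) := by linarith
  have k₁₁ : (v₁ + B₁) ≤ (u₁ + A₁) := by linarith [neg_le_of_abs_le m₁₁]
  have k₂₁ : (v₁ + B₁) ≤ (u₂ + A₂) := by linarith [neg_le_of_abs_le m₂₁]
  have k₃₁ : (v₁ + B₁) ≤ (u₃ + A₃) := by linarith [neg_le_of_abs_le m₃₁]
  have k₄₁ : (v₁ + B₁) ≤ (u₄ + A₄) := by linarith [neg_le_of_abs_le m₄₁]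
  have k₅₁ : (v₁ + B₁) ≤ (u₅ + A₅) := by linarith [neg_le_of_abs_le m₅₁]
  have k₁₂ : (v₂ + B₂) ≤ (u₁ + A₁) := by linarith [neg_le_of_abs_le m₁₂]
  have k₂₂ : (v₂ + B₂) ≤ (u₂ + A₂) := by linarith [neg_le_of_abs_le m₂₂]
  have k₃₂ : (v₂ + B₂) ≤ (u₃ + A₃) := by linarith [neg_le_of_abs_le m₃₂]
  have k₄₂ : (v₂ + B₂) ≤ (u₄ + A₄) := by linarith [neg_le_of_abs_le m₄₂]
  have k₅₂ : (v₂ + B₂) ≤ (u₅ + A₅) := by linarith [neg_le_of_abs_le m₅₂]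
  have k₁₃ : (v₃ + B₃) ≤ (u₁ + A₁) := by linarith [neg_le_of_abs_le m₁₃]
  have k₂₃ : (v₃ + B₃) ≤ (u₂ + A₂) := by linarith [neg_le_of_abs_le m₂₃]
  have k₃₃ : (v₃ + B₃) ≤ (u₃ + A₃) := by linarith [neg_le_of_abs_le m₃₃]
  have k₄₃ : (v₃ + B₃) ≤ (u₄ + A₄) := by linarith [neg_le_of_abs_le m₄₃]
  have k₅₃ : (v₃ + B₃) ≤ (u₅ + A₅) := by linarith [neg_le_of_abs_le m₅₃]
  refine ⟨p3_nonneg_sep (u₁ + A₁) (u₂ + A₂) (u₃ + A₃) (u₄ + A₄) (u₅ + A₅) (v₁ + B₁) (v₂ + B₂) (v₃ + B₃) h k₁₁ k₂₁ k₃₁ k₄₁ k₅₁ k₁₂ k₂₂ k₃₂ k₄₂ k₅₂ k₁₃ k₂₃ k₃₃ k₄₃ k₅₃, ?_⟩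
  have h4 := e4_nonneg_sep (u₁ + A₁) (u₂ + A₂) (u₃ + A₃) (u₄ + A₄) (u₅ + A₅) (v₁ + B₁) (v₂ + B₂) (v₃ + B₃) h k₁₁ k₂₁ k₃₁ k₄₁ k₅₁ k₁₂ k₂₂ k₃₂ k₄₂ k₅₂ k₁₃ k₂₃ k₃₃ k₄₃ k₅₃
  linarith

/-- LIGHT-CONE NECESSARY CONDITIONS at time `y = −1` (`M = A − u`): `Σ_E (A−u)³ − Σ_F (B−v)³ ≥ 0` and `Q₄(M) ≤ 0`. -/
theorem lightcone_minus (A₁ A₂ A₃ A₄ A₅ B₁ B₂ B₃ u₁ u₂ u₃ u₄ u₅ v₁ v₂ v₃ : ℝ)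
    (hA : A₁ + A₂ + A₃ + A₄ + A₅ = B₁ + B₂ + B₃) (hC : u₁ + u₂ + u₃ + u₄ + u₅ = v₁ + v₂ + v₃)
    (m₁₁ : |u₁ - v₁| ≤ A₁ - B₁) (m₂₁ : |u₂ - v₁| ≤ A₂ - B₁) (m₃₁ : |u₃ - v₁| ≤ A₃ - B₁) (m₄₁ : |u₄ - v₁| ≤ A₄ - B₁) (m₅₁ : |u₅ - v₁| ≤ A₅ - B₁)
    (m₁₂ : |u₁ - v₂| ≤ A₁ - B₂) (m₂₂ : |u₂ - v₂| ≤ A₂ - B₂) (m₃₂ : |u₃ - v₂| ≤ A₃ - B₂) (m₄₂ : |u₄ - v₂| ≤ A₄ - B₂) (m₅₂ : |u₅ - v₂| ≤ A₅ - B₂)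
    (m₁₃ : |u₁ - v₃| ≤ A₁ - B₃) (m₂₃ : |u₂ - v₃| ≤ A₂ - B₃) (m₃₃ : |u₃ - v₃| ≤ A₃ - B₃) (m₄₃ : |u₄ - v₃| ≤ A₄ - B₃) (m₅₃ : |u₅ - v₃| ≤ A₅ - B₃) :
    0 ≤ (((A₁ - u₁) ^ 3 + (A₂ - u₂) ^ 3 + (A₃ - u₃) ^ 3 + (A₄ - u₄) ^ 3 + (A₅ - u₅) ^ 3) - ((B₁ - v₁) ^ 3 + (B₂ - v₂) ^ 3 + (B₃ - v₃) ^ 3))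
    ∧ 3 * (((A₁ - u₁) ^ 4 + (A₂ - u₂) ^ 4 + (A₃ - u₃) ^ 4 + (A₄ - u₄) ^ 4 + (A₅ - u₅) ^ 4) - ((B₁ - v₁) ^ 4 + (B₂ - v₂) ^ 4 + (B₃ - v₃) ^ 4)) - (3 / 2) * (((A₁ - u₁) ^ 2 + (A₂ - u₂) ^ 2 + (A₃ - u₃) ^ 2 + (A₄ - u₄) ^ 2 + (A₅ - u₅) ^ 2) - ((B₁ - v₁) ^ 2 + (B₂ - v₂) ^ 2 + (B₃ - v₃) ^ 2)) ^ 2 ≤ 0 := by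
  have h : (A₁ - u₁) + (A₂ - u₂) + (A₃ - u₃) + (A₄ - u₄) + (A₅ - u₅) = (B₁ - v₁) + (B₂ - v₂) + (B₃ - v₃) := by linarith
  have k₁₁ : (B₁ - v₁) ≤ (A₁ - u₁) := by linarith [le_of_abs_le m₁₁]
  have k₂₁ : (B₁ - v₁) ≤ (A₂ - u₂) := by linarith [le_of_abs_le m₂₁]
  have k₃₁ : (B₁ - v₁) ≤ (A₃ - u₃) := by linarith [le_of_abs_le m₃₁]
  have k₄₁ : (B₁ - v₁) ≤ (A₄ - u₄) := by linarith [le_of_abs_le m₄₁]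
  have k₅₁ : (B₁ - v₁) ≤ (A₅ - u₅) := by linarith [le_of_abs_le m₅₁]
  have k₁₂ : (B₂ - v₂) ≤ (A₁ - u₁) := by linarith [le_of_abs_le m₁₂]
  have k₂₂ : (B₂ - v₂) ≤ (A₂ - u₂) := by linarith [le_of_abs_le m₂₂]
  have k₃₂ : (B₂ - v₂) ≤ (A₃ - u₃) := by linarith [le_of_abs_le m₃₂]
  have k₄₂ : (B₂ - v₂) ≤ (A₄ - u₄) := by linarith [le_of_abs_le m₄₂]
  have k₅₂ : (B₂ - v₂) ≤ (A₅ - u₅) := by linarith [le_of_abs_le m₅₂]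
  have k₁₃ : (B₃ - v₃) ≤ (A₁ - u₁) := by linarith [le_of_abs_le m₁₃]
  have k₂₃ : (B₃ - v₃) ≤ (A₂ - u₂) := by linarith [le_of_abs_le m₂₃]
  have k₃₃ : (B₃ - v₃) ≤ (A₃ - u₃) := by linarith [le_of_abs_le m₃₃]
  have k₄₃ : (B₃ - v₃) ≤ (A₄ - u₄) := by linarith [le_of_abs_le m₄₃]
  have k₅₃ : (B₃ - v₃) ≤ (A₅ - u₅) := by linarith [le_of_abs_le m₅₃]
  refine ⟨p3_nonneg_sep (A₁ - u₁) (A₂ - u₂) (A₃ - u₃) (A₄ - u₄) (A₅ - u₅) (B₁ - v₁) (B₂ - v₂) (B₃ - v₃) h k₁₁ k₂₁ k₃₁ k₄₁ k₅₁ k₁₂ k₂₂ k₃₂ k₄₂ k₅₂ k₁₃ k₂₃ k₃₃ k₄₃ k₅₃, ?_⟩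
  have h4 := e4_nonneg_sep (A₁ - u₁) (A₂ - u₂) (A₃ - u₃) (A₄ - u₄) (A₅ - u₅) (B₁ - v₁) (B₂ - v₂) (B₃ - v₃) h k₁₁ k₂₁ k₃₁ k₄₁ k₅₁ k₁₂ k₂₂ k₃₂ k₄₂ k₅₂ k₁₃ k₂₃ k₃₃ k₄₃ k₅₃
  linarith

end Summit.HodgeConjecture.HodgeConjecture.WeilClassTestSeparatedAlphabet
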